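import Mathlib.Data.List.Nodup
import Mathlib.Data.Finset.Card
import Mathlib.Algebra.BigOperators.Group.Finset.Basic
import Mathlib.Algebra.Order.Ring.Abs
import HarnessLib

/-!
# Venture HSemireg — honest letter budgets: a duplicate-free word visits a letter at most as
# often as the letter has copies

Elementary counting behind «LEMMA HONEST (ii)» of the computation cell `pub-hsemireg` (seat
w1-aut-1, `widen/W1/HONESTWORD-w1aut1.md` §1; reads: w1-cx-2 CONCUR, ref-w-1; machine use:
the letter budgets of `cegar_honest` / `honest3` / `h3lazy`, TABLE-W1 rows W1CX-31, W1AUT-33–35,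
W1AUT-B28). Companion of `OneSidedWordNodup.lean` (LEMMA HONEST (i): the copies met by a
THEOREM-LOOP word of a one-sided complex are pairwise distinct).

Setting on paper (NOT in this file): a twisted complex is a finite set `S` of COPIES `u`, each a
copy of a LETTER `letter u` (a line bundle of the design) placed in a degree `d u`; its class is
the signed design `∑ⱼ wⱼ [Lⱼ]` with `wⱼ = ∑_{u : letter u = j} (−1)^{d u}`; the complex is
PARITY-PURE at `j` when all copies of `j` sit in degrees of one parity, so that the signs
`(−1)^{d u}` on the fibre of `j` are all equal and `|wⱼ|` IS the number of copies of `j`. A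
cancelling word through a copy `x` meets a duplicate-free list of copies `x :: rest`
(LEMMA HONEST (i)); hence it enters a letter `j ≠ letter x` at most `|wⱼ|` times and the letter
of `x` at most `|w_{letter x}| − 1` further times. These are the LETTER BUDGETS that make the
honest instruments finite and sound.

What is recorded (unbundled: a finite set `S` of copies, a labelling `letter : N → L`, signs
`s : N → ℤ`; no complex is constructed):

* `countP_le_card_fibre` — a duplicate-free list inside `S` visits the letter `j` at most
  `#(copies of j in S)` times;
* `countP_tail_le_card_fibre_sub_one` — for a duplicate-free `x :: rest` inside `S`, `rest`
  visits the letter of `x` at most `#(copies of letter x) − 1` times;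
* `natAbs_sum_eq_card_of_const_sign` — PARITY-PURE bookkeeping: if the signs on a finite set are
  all equal to one `ε = ±1`, the signed count has absolute value the number of elements;
* `budget_other` / `budget_self` — **LEMMA HONEST (ii)**: with `wⱼ` the signed count over the
  fibre of `j` and the fibre parity-pure, a duplicate-free word `x :: rest` inside `S` visits
  `j` at most `|wⱼ|` times, and `rest` visits the letter of `x` at most `|w_{letter x}| − 1` times;
* `card_fibre_eq_natAbs_weight` — in a parity-pure realisation the letter `j` has exactly `|wⱼ|`
  copies.

HONEST FRAMING. Counting on finite lists and finite sets only; the Lean index of one step of a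
NECESSARY-condition sieve used by the cell. No sheaf, complex, abelian variety or semiregularity
map appears; nothing here says that HC, HC_CM or HC_AV holds, and nothing here is a new case of
anything.
-/

namespace Summit.Ventures.HSemireg

namespace HonestLetterBudget

open Finset

variable {N L : Type*} [DecidableEq N] [DecidableEq L]

/-- A duplicate-free list of copies drawn from `S` visits the letter `j` at most as many times as
`S` has copies of `j`. -/
theorem countP_le_card_fibre (S : Finset N) (letter : N → L) (j : L) (w : List N)
    (hw : w.Nodup) (hS : ∀ u ∈ w, u ∈ S) :
    w.countP (fun u => letter u = j) ≤ #(S.filter fun u => letter u = j) := by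
  rw [List.countP_eq_length_filter, ← List.toFinset_card_of_nodup (hw.filter _)]
  refine Finset.card_le_card fun u hu => ?_
  rw [List.mem_toFinset, List.mem_filter] at hu
  exact Finset.mem_filter.mpr ⟨hS u hu.1, by simpa using hu.2⟩

/-- For a duplicate-free word `x :: rest` drawn from `S`, the tail `rest` visits the letter of `x`
at most `#(copies of that letter in S) − 1` times (the copy `x` itself is used up). -/
theorem countP_tail_le_card_fibre_sub_one (S : Finset N) (letter : N → L) (x : N)
    (rest : List N) (hw : (x :: rest).Nodup) (hS : ∀ u ∈ x :: rest, u ∈ S) :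
    rest.countP (fun u => letter u = letter x)
      ≤ #(S.filter fun u => letter u = letter x) - 1 := by
  have hx : x ∉ rest := (List.nodup_cons.mp hw).1
  have hrest : rest.Nodup := (List.nodup_cons.mp hw).2
  have hsub : ∀ u ∈ rest, u ∈ S.erase x := fun u hu =>
    Finset.mem_erase.mpr ⟨fun h => hx (h ▸ hu), hS u (List.mem_cons_of_mem x hu)⟩
  have h := countP_le_card_fibre (S.erase x) letter (letter x) rest hrest hsub
  have hxS : x ∈ S.filter fun u => letter u = letter x :=
    Finset.mem_filter.mpr ⟨hS x List.mem_cons_self, rfl⟩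
  rwa [Finset.filter_erase, Finset.card_erase_of_mem hxS] at h

omit [DecidableEq N] in
/-- PARITY-PURE bookkeeping: if the signs `s u` on a finite set `T` are all equal to one
`ε ∈ {1, −1}`, then the signed count `∑_{u ∈ T} s u` has absolute value `#T`. (On paper:
`s u = (−1)^{d u}` and all degrees `d u` of the copies of one letter have the same parity.) -/
theorem natAbs_sum_eq_card_of_const_sign (T : Finset N) (s : N → ℤ) (ε : ℤ)
    (hε : ε = 1 ∨ ε = -1) (hs : ∀ u ∈ T, s u = ε) :
    (∑ u ∈ T, s u).natAbs = #T := by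
  rw [Finset.sum_congr rfl hs, Finset.sum_const]
  rcases hε with rfl | rfl <;> simp

/-- **LEMMA HONEST (ii), other letters.** Let `wⱼ = ∑_{u ∈ S, letter u = j} s u` be the design
weight of the letter `j`, the fibre of `j` parity-pure (`s = ε = ±1` on it). Then a duplicate-free
word drawn from `S` visits `j` at most `|wⱼ|` times. -/
theorem budget_other (S : Finset N) (letter : N → L) (s : N → ℤ) (j : L) (ε : ℤ)
    (hε : ε = 1 ∨ ε = -1) (hs : ∀ u ∈ S.filter (fun u => letter u = j), s u = ε)
    (w : List N) (hw : w.Nodup) (hS : ∀ u ∈ w, u ∈ S) :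
    w.countP (fun u => letter u = j) ≤ (∑ u ∈ S.filter (fun u => letter u = j), s u).natAbs := by
  rw [natAbs_sum_eq_card_of_const_sign _ s ε hε hs]
  exact countP_le_card_fibre S letter j w hw hS

/-- **LEMMA HONEST (ii), the word's own letter.** With `ℓ = letter x` and the fibre of `ℓ`
parity-pure, the tail of a duplicate-free word `x :: rest` drawn from `S` visits `ℓ` at most
`|w_ℓ| − 1` times. -/
theorem budget_self (S : Finset N) (letter : N → L) (s : N → ℤ) (x : N) (ε : ℤ)
    (hε : ε = 1 ∨ ε = -1) (hs : ∀ u ∈ S.filter (fun u => letter u = letter x), s u = ε)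
    (rest : List N) (hw : (x :: rest).Nodup) (hS : ∀ u ∈ x :: rest, u ∈ S) :
    rest.countP (fun u => letter u = letter x)
      ≤ (∑ u ∈ S.filter (fun u => letter u = letter x), s u).natAbs - 1 := by
  rw [natAbs_sum_eq_card_of_const_sign _ s ε hε hs]
  exact countP_tail_le_card_fibre_sub_one S letter x rest hw hS

omit [DecidableEq N] in
/-- The number of copies of a letter is recovered from the design: in a parity-pure realisation
the letter `j` has exactly `|wⱼ|` copies in `S`. -/
theorem card_fibre_eq_natAbs_weight (S : Finset N) (letter : N → L) (s : N → ℤ) (j : L) (ε : ℤ)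
    (hε : ε = 1 ∨ ε = -1) (hs : ∀ u ∈ S.filter (fun u => letter u = j), s u = ε) :
    #(S.filter fun u => letter u = j) = (∑ u ∈ S.filter (fun u => letter u = j), s u).natAbs :=
  (natAbs_sum_eq_card_of_const_sign _ s ε hε hs).symm

end HonestLetterBudget

end Summit.Ventures.HSemireg
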